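import Summits.KontsevichZagierPeriods.KontsevichZagierPeriods.Theorems.HurwitzMicroSectorsNormalFormPrincipleEvenZetaReduction

/-!
# `NormalFormPrinciple` (stmt-KontsevichZagierPeriods-3869), line `SketchIdeator1` — leaf `stub_boxRigidity`:
# THE EVEN ZETA VALUES LAYER, II: Conjecture 1 (kernel form), jointly over all even weights

Every element of the subgroup of `FormalRep` generated by the diagonal level-one boxes of even weights
(`ℚ̄`-polynomial numerators), the constant boxes and the algebraic points has the normal form
`[pt, q] + Σ_k [(0,1)^{2k}, β_k/(1 − Πxₗ)]` modulo relations with `q, β_k` real algebraic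
(`exists_nf_of_mem_closure`); its value is `q + Σ_k β_k ζ(2k) = q + Σ_k β_k r_k π^{2k}` with
`r_k ∈ ℚ^×` (Euler), and `π²` is transcendental (Lindemann) — so value `0` forces `q = 0`, `β_k = 0`
(`even_zeta_rigid`) and the element is a relation: CONJECTURE 1 OF KONTSEVICH–ZAGIER HOLDS, IN KERNEL
FORM, ON THE EVEN ZETA VALUES LAYER, UNCONDITIONALLY AND JOINTLY OVER ALL EVEN WEIGHTS
(`evenZeta_mem_relations_of_eval_eq_zero_of_mem_closure`). Values covered: the `ℚ̄`-span of
`1, π², π⁴, …` as realised by these boxes. [cite: KontsevichZagier2001, §1.2 Conjecture 1]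
No new definitions.
-/

noncomputable section

open MeasureTheory Set
open Literature.NumberTheory.Transcendental Literature.NumberTheory.Transcendental.KZ
open Literature.ModelTheory.ExponentialFields (IsSemialgebraic)

namespace Summit.KontsevichZagierPeriods.HurwitzMicroSectors.NormalFormPrinciple.PiBox.EvenZeta

open Summit.KontsevichZagierPeriods.HurwitzMicroSectors.NormalFormPrinciple.PiBox.Dlog
  (pt_add_mem_relations pt_zero_mem_relations pt_congr_mem_relations exists_ptCarrierA)
open Summit.KontsevichZagierPeriods.HurwitzMicroSectors.NormalFormPrinciple.PiBox.Dlog.K22 (mk_eq_mk_of_sub_mem)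
open Summit.KontsevichZagierPeriods.HurwitzMicroSectors.NormalFormPrinciple.PiBox.AlgLevelOne
  (isAlgebraic_add' isAlgebraic_neg')

/-! ## Normal forms of the generators -/

/-- **Existence of the diagonal even box** `[(0,1)^{2(k+1)}, (Σ_{i∈S} cᵢ tⁱ)/(1 − t)]` for algebraic
coefficients. [cite: KontsevichZagier2001, §1.1] -/
theorem exists_diagPolyRep (k : ℕ) (S : Finset ℕ) (coef : ℕ → ℝ) (halg : ∀ i ∈ S, IsAlgebraic ℚ (coef i)) :
    ∃ N : IntegralRep (2 * (k + 1)), N.domain = {x | ∀ i, x i ∈ Set.Ioo (0:ℝ) 1} ∧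
      N.integrand = fun x => (∑ i ∈ S, coef i * (∏ l, x l) ^ i) / (1 - ∏ l, x l) := by
  classical
  induction S using Finset.induction_on with
  | empty =>
    obtain ⟨-, -, hexZ⟩ := exists_boxes 0 isAlgebraic_zero
    obtain ⟨N, hNd, hNi⟩ := hexZ (2 * (k + 1)) 0 (by omega)
    refine ⟨N, hNd, ?_⟩
    rw [hNi]; funext x; simp
  | insert s S hs ih =>
    obtain ⟨N₁, hN₁d, hN₁i⟩ := ih fun t ht => halg t (Finset.mem_insert_of_mem ht)
    obtain ⟨-, -, hexZ⟩ := exists_boxes (coef s) (halg s (Finset.mem_insert_self s S))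
    obtain ⟨N₂, hN₂d, hN₂i⟩ := hexZ (2 * (k + 1)) s (by omega)
    refine ⟨⟨N₁.domain, fun x => (∑ i ∈ insert s S, coef i * (∏ l, x l) ^ i) / (1 - ∏ l, x l),
      N₁.isSemialgebraic_domain, ?_, ?_⟩, hN₁d, rfl⟩
    · refine (IsSemialgebraicFunOn.add_holds (hN₂d.trans hN₁d.symm ▸ N₂.isSemialgebraicFunOn_integrand)
        N₁.isSemialgebraicFunOn_integrand).congr fun x _ => ?_
      rw [hN₁i, hN₂i]; simp only [Pi.add_apply, Finset.sum_insert hs]; ring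
    · have h := ((hN₂d.trans hN₁d.symm) ▸ N₂.integrableOn).add N₁.integrableOn
      refine h.congr_fun (fun x _ => ?_) (IntegralRep.measurableSet_domain_holds N₁)
      rw [hN₁i, hN₂i]; simp only [Pi.add_apply, Finset.sum_insert hs]; ring

/-- **Normal form of a diagonal even monomial box** in the class group. [cite: KontsevichZagier2001, §1.2] -/
theorem nf_diagMonomial (Zf : ℝ → IntegralRep 0) (hZf : ∀ r, IsAlgebraic ℚ r → (Zf r).domain = Set.univ ∧ ((Zf r).integrand = fun _ => r))
    (Bf : (k : ℕ) → ℝ → IntegralRep (2 * (k + 1)))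
    (hBf : ∀ k c, IsAlgebraic ℚ c → (Bf k c).domain = {x | ∀ i, x i ∈ Set.Ioo (0:ℝ) 1} ∧
      ((Bf k c).integrand = fun x => c * (∏ l, x l) ^ 0 / (1 - ∏ l, x l))) (k : ℕ) (c : ℝ) (hc : IsAlgebraic ℚ c) (m : ℕ)
    (N : IntegralRep (2 * (k + 1))) (hNd : N.domain = {x | ∀ i, x i ∈ Set.Ioo (0:ℝ) 1})
    (hNi : EqOn N.integrand (fun x => c * (∏ l, x l) ^ m / (1 - ∏ l, x l)) N.domain) :
    ∃ (q : ℝ) (T : Finset ℕ) (β : ℕ → ℝ), IsAlgebraic ℚ q ∧ (∀ k ∈ T, IsAlgebraic ℚ (β k)) ∧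
      QuotientAddGroup.mk' relations (of N) =
        QuotientAddGroup.mk' relations (of (Zf q)) + ∑ k ∈ T, QuotientAddGroup.mk' relations (of (Bf k (β k))) := by
  have hq' : ∀ n : ℕ, IsAlgebraic ℚ (∑ i ∈ Finset.range n, c / (((i + 1) ^ (2 * (k + 1)) : ℕ) : ℝ)) := by
    intro n
    induction n with
    | zero => simpa using isAlgebraic_zero
    | succ n ih =>
      rw [Finset.sum_range_succ]
      refine isAlgebraic_add' ih ?_
      have e : c / (((n + 1) ^ (2 * (k + 1)) : ℕ) : ℝ) = c * ((1 / ((n + 1) ^ (2 * (k + 1)) : ℕ) : ℚ) : ℝ) := by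
        push_cast; ring
      rw [e]; exact ez_isAlgebraic_mul_ratCast hc _
  have hq : IsAlgebraic ℚ (-(∑ i ∈ Finset.range m, c / (((i + 1) ^ (2 * (k + 1)) : ℕ) : ℝ))) :=
    isAlgebraic_neg' (hq' m)
  refine ⟨_, {k}, fun _ => c, hq, fun _ _ => hc, ?_⟩
  rw [Finset.sum_singleton, ← map_add]
  refine mk_eq_mk_of_sub_mem ?_
  have e : of N - (of (Zf (-(∑ i ∈ Finset.range m, c / (((i + 1) ^ (2 * (k + 1)) : ℕ) : ℝ)))) + of (Bf k c)) =
      of N - of (Bf k c) - of (Zf (-(∑ i ∈ Finset.range m, c / (((i + 1) ^ (2 * (k + 1)) : ℕ) : ℝ)))) := by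
    abel
  rw [e]
  exact diagMonomial_normalForm c hc (2 * (k + 1)) (by omega) m N (Bf k c) (Zf _) hNd hNi (hBf k c hc).1
    ((hBf k c hc).2 ▸ fun _ _ => rfl) (hZf _ hq).1 (hZf _ hq).2

/-- **Normal form of a diagonal even box with polynomial numerator.** [cite: KontsevichZagier2001, §1.2] -/
theorem nf_diagPoly (Zf : ℝ → IntegralRep 0) (hZf : ∀ r, IsAlgebraic ℚ r → (Zf r).domain = Set.univ ∧ ((Zf r).integrand = fun _ => r))
    (Bf : (k : ℕ) → ℝ → IntegralRep (2 * (k + 1)))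
    (hBf : ∀ k c, IsAlgebraic ℚ c → (Bf k c).domain = {x | ∀ i, x i ∈ Set.Ioo (0:ℝ) 1} ∧
      ((Bf k c).integrand = fun x => c * (∏ l, x l) ^ 0 / (1 - ∏ l, x l))) (k : ℕ) (coef : ℕ → ℝ) :
    ∀ (S : Finset ℕ), (∀ i ∈ S, IsAlgebraic ℚ (coef i)) → ∀ (N : IntegralRep (2 * (k + 1))),
    N.domain = {x | ∀ i, x i ∈ Set.Ioo (0:ℝ) 1} →
    EqOn N.integrand (fun x => (∑ i ∈ S, coef i * (∏ l, x l) ^ i) / (1 - ∏ l, x l)) N.domain →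
    ∃ (q : ℝ) (T : Finset ℕ) (β : ℕ → ℝ), IsAlgebraic ℚ q ∧ (∀ k ∈ T, IsAlgebraic ℚ (β k)) ∧
      QuotientAddGroup.mk' relations (of N) =
        QuotientAddGroup.mk' relations (of (Zf q)) + ∑ k ∈ T, QuotientAddGroup.mk' relations (of (Bf k (β k))) := by
  classical
  intro S
  induction S using Finset.induction_on with
  | empty =>
    intro _ N hNd hNi
    refine ⟨0, ∅, fun _ => 0, isAlgebraic_zero, fun _ h => (Finset.notMem_empty _ h).elim, ?_⟩
    rw [Finset.sum_empty, add_zero, ptCarrier_zero Zf hZf, QuotientAddGroup.mk'_apply, QuotientAddGroup.eq_zero_iff]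
    exact of_mem_relations_of_eqOn_zero N fun x hx => by rw [hNi hx]; simp
  | insert s S hs ih =>
    intro halg N hNd hNi
    have halgS : ∀ t ∈ S, IsAlgebraic ℚ (coef t) := fun t ht => halg t (Finset.mem_insert_of_mem ht)
    have halgs : IsAlgebraic ℚ (coef s) := halg s (Finset.mem_insert_self s S)
    obtain ⟨N₁, hN₁d, hN₁i⟩ := exists_diagPolyRep k S coef halgS
    obtain ⟨-, -, hexZ⟩ := exists_boxes (coef s) halgs
    obtain ⟨N₂, hN₂d, hN₂i⟩ := hexZ (2 * (k + 1)) s (by omega)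
    have h₁ := ih halgS N₁ hN₁d (hN₁i ▸ fun _ _ => rfl)
    have h₂ := nf_diagMonomial Zf hZf Bf hBf k (coef s) halgs s N₂ hN₂d (hN₂i ▸ fun _ _ => rfl)
    have eN : of N - of N₂ - of N₁ ∈ relations := by
      refine integrandAddRel_subset_relations ⟨_, N, N₂, N₁, hN₂d.trans hNd.symm, hN₁d.trans hNd.symm,
        fun x hx => ?_, rfl⟩
      rw [Pi.add_apply, hNi hx, hN₁i, hN₂i]
      simp only [Finset.sum_insert hs]
      ring
    have eN' : of N - (of N₂ + of N₁) ∈ relations := by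
      have e : of N - (of N₂ + of N₁) = of N - of N₂ - of N₁ := by abel
      rw [e]; exact eN
    have hmk : QuotientAddGroup.mk' relations (of N) = QuotientAddGroup.mk' relations (of N₂ + of N₁) :=
      mk_eq_mk_of_sub_mem eN'
    obtain ⟨q, T, β, hq, hβ, h⟩ := nf_add Zf hZf Bf hBf h₂ h₁
    exact ⟨q, T, β, hq, hβ, hmk.trans h⟩

/-- **Normal forms on the subgroup generated by the diagonal even boxes, the constant boxes and the
algebraic points.** [cite: KontsevichZagier2001, §1.2] -/
theorem exists_nf_of_mem_closure (Zf : ℝ → IntegralRep 0) (hZf : ∀ r, IsAlgebraic ℚ r → (Zf r).domain = Set.univ ∧ ((Zf r).integrand = fun _ => r))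
    (Bf : (k : ℕ) → ℝ → IntegralRep (2 * (k + 1)))
    (hBf : ∀ k c, IsAlgebraic ℚ c → (Bf k c).domain = {x | ∀ i, x i ∈ Set.Ioo (0:ℝ) 1} ∧
      ((Bf k c).integrand = fun x => c * (∏ l, x l) ^ 0 / (1 - ∏ l, x l))) {x : FormalRep}
    (hx : x ∈ AddSubgroup.closure
      ({y : FormalRep | ∃ (k : ℕ) (S : Finset ℕ) (coef : ℕ → ℝ) (N : IntegralRep (2 * (k + 1))),
          (∀ i ∈ S, IsAlgebraic ℚ (coef i)) ∧ N.domain = {x | ∀ i, x i ∈ Set.Ioo (0:ℝ) 1} ∧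
          EqOn N.integrand (fun x => (∑ i ∈ S, coef i * (∏ l, x l) ^ i) / (1 - ∏ l, x l)) N.domain ∧
          y = of N} ∪
       {y : FormalRep | ∃ (w : ℕ) (c : ℝ) (N : IntegralRep w), IsAlgebraic ℚ c ∧
          N.domain = {x | ∀ i, x i ∈ Set.Ioo (0:ℝ) 1} ∧ EqOn N.integrand (fun _ => c) N.domain ∧ y = of N} ∪
       {y : FormalRep | ∃ (r : ℝ) (Z : IntegralRep 0), IsAlgebraic ℚ r ∧ Z.domain = Set.univ ∧
          (Z.integrand = fun _ => r) ∧ y = of Z})) :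
    ∃ (q : ℝ) (T : Finset ℕ) (β : ℕ → ℝ), IsAlgebraic ℚ q ∧ (∀ k ∈ T, IsAlgebraic ℚ (β k)) ∧
      QuotientAddGroup.mk' relations x =
        QuotientAddGroup.mk' relations (of (Zf q)) + ∑ k ∈ T, QuotientAddGroup.mk' relations (of (Bf k (β k))) := by
  induction hx using AddSubgroup.closure_induction with
  | mem y hy =>
    rcases hy with (hy | hy) | hy
    · obtain ⟨k, S, coef, N, halg, hNd, hNi, rfl⟩ := hy
      exact nf_diagPoly Zf hZf Bf hBf k coef S halg N hNd hNi
    · obtain ⟨w, c, N, hc, hNd, hNi, rfl⟩ := hy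
      refine ⟨c, ∅, fun _ => 0, hc, fun _ h => (Finset.notMem_empty _ h).elim, ?_⟩
      rw [Finset.sum_empty, add_zero]
      exact mk_eq_mk_of_sub_mem (constBox_sub_pt c hc w N (Zf c) hNd hNi (hZf c hc).1 (hZf c hc).2)
    · obtain ⟨r, Z, hr, hZd, hZi, rfl⟩ := hy
      refine ⟨r, ∅, fun _ => 0, hr, fun _ h => (Finset.notMem_empty _ h).elim, ?_⟩
      rw [Finset.sum_empty, add_zero]
      exact mk_eq_mk_of_sub_mem (pt_congr_mem_relations Z (Zf r) hZd (hZf r hr).1 hZi (hZf r hr).2)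
  | zero =>
    refine ⟨0, ∅, fun _ => 0, isAlgebraic_zero, fun _ h => (Finset.notMem_empty _ h).elim, ?_⟩
    rw [Finset.sum_empty, add_zero, ptCarrier_zero Zf hZf, map_zero]
  | add y z _ _ ihy ihz => exact nf_add Zf hZf Bf hBf ihy ihz
  | neg y _ ihy => exact nf_neg Zf hZf Bf hBf ihy

/-- **Conjecture 1 of Kontsevich–Zagier, kernel form, for THE EVEN ZETA VALUES LAYER** —
unconditionally: a formal `ℤ`-combination of diagonal level-one boxes of even weights
`[(0,1)^{2k}, P(Πxₗ)/(1 − Πxₗ)]` (`P ∈ (ℚ̄ ∩ ℝ)[t]`; values `q + β ζ(2k)`), of constant boxes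
`[(0,1)^w, c]` and of algebraic points, with value `0`, is a relation. Normal form
`[pt, q] + Σ_k [(0,1)^{2k}, β_k/(1 − Πxₗ)]`, value `q + Σ β_k ζ(2k) = q + Σ β_k r_k π^{2k}`
(`r_k ∈ ℚ^×`, Euler), rigid by the transcendence of `π` (Lindemann): jointly over ALL EVEN WEIGHTS.
[cite: KontsevichZagier2001, §1.2 Conjecture 1] -/
theorem evenZeta_mem_relations_of_eval_eq_zero_of_mem_closure {x : FormalRep}
    (hx : x ∈ AddSubgroup.closure
      ({y : FormalRep | ∃ (k : ℕ) (S : Finset ℕ) (coef : ℕ → ℝ) (N : IntegralRep (2 * (k + 1))),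
          (∀ i ∈ S, IsAlgebraic ℚ (coef i)) ∧ N.domain = {x | ∀ i, x i ∈ Set.Ioo (0:ℝ) 1} ∧
          EqOn N.integrand (fun x => (∑ i ∈ S, coef i * (∏ l, x l) ^ i) / (1 - ∏ l, x l)) N.domain ∧
          y = of N} ∪
       {y : FormalRep | ∃ (w : ℕ) (c : ℝ) (N : IntegralRep w), IsAlgebraic ℚ c ∧
          N.domain = {x | ∀ i, x i ∈ Set.Ioo (0:ℝ) 1} ∧ EqOn N.integrand (fun _ => c) N.domain ∧ y = of N} ∪
       {y : FormalRep | ∃ (r : ℝ) (Z : IntegralRep 0), IsAlgebraic ℚ r ∧ Z.domain = Set.univ ∧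
          (Z.integrand = fun _ => r) ∧ y = of Z}))
    (hv : eval x = 0) : x ∈ relations := by
  classical
  obtain ⟨Zf, hZf⟩ := exists_ptCarrierA
  obtain ⟨Bf, hBf⟩ := exists_zetaCarrier
  obtain ⟨hvalC, hvalB⟩ := value_kit
  obtain ⟨q, T, β, hq, hβ, h⟩ := exists_nf_of_mem_closure Zf hZf Bf hBf hx
  -- the value of the normal form
  have hsub : x - (of (Zf q) + ∑ k ∈ T, of (Bf k (β k))) ∈ relations := by
    rw [← QuotientAddGroup.eq_iff_sub_mem, ← QuotientAddGroup.mk'_apply, ← QuotientAddGroup.mk'_apply, h,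
      map_add, map_sum]
  have h0 := relations_le_ker_eval_holds hsub
  rw [AddMonoidHom.mem_ker, map_sub, hv, zero_sub, neg_eq_zero, map_add, map_sum, eval_of] at h0
  simp only [eval_of] at h0
  have hZv : (Zf q).value = q :=
    hvalC 0 q (Zf q) (by rw [(hZf q hq).1]; ext x; simp) (by rw [(hZf q hq).2]; exact fun _ _ => rfl)
  have hBv : ∀ k ∈ T, (Bf k (β k)).value = β k * zetaValue (2 * (k + 1)) := fun k hk =>
    hvalB _ (β k) (Bf k (β k)) (by omega) (hBf k _ (hβ k hk)).1 fun x _ => by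
      rw [(hBf k _ (hβ k hk)).2]; simp
  rw [hZv, Finset.sum_congr rfl hBv] at h0
  obtain ⟨rfl, hβ0⟩ := even_zeta_rigid T β q hβ hq h0
  -- all data vanish
  have hcl : QuotientAddGroup.mk' relations x = 0 := by
    rw [h, ptCarrier_zero Zf hZf, zero_add]
    exact Finset.sum_eq_zero fun k hk => by rw [hβ0 k hk]; exact zetaCarrier_zero Bf hBf k
  rwa [QuotientAddGroup.mk'_apply, QuotientAddGroup.eq_zero_iff] at hcl

/-- **Two diagonal even boxes (possibly of different even weights) with equal values are
KZ-equivalent** — unconditionally (e.g. `[(0,1)⁴, 90(1 − t + t²… )/(1−t)]`-type identities; across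
weights only `0 = 0` can occur, `π²` being transcendental). [cite: KontsevichZagier2001, §1.2 Conjecture 1] -/
theorem evenZeta_equivalent_of_value_eq (k k' : ℕ) (S S' : Finset ℕ) (coef coef' : ℕ → ℝ)
    (halg : ∀ i ∈ S, IsAlgebraic ℚ (coef i)) (halg' : ∀ i ∈ S', IsAlgebraic ℚ (coef' i))
    (N : IntegralRep (2 * (k + 1))) (N' : IntegralRep (2 * (k' + 1)))
    (hNd : N.domain = {x | ∀ i, x i ∈ Set.Ioo (0:ℝ) 1})
    (hNi : EqOn N.integrand (fun x => (∑ i ∈ S, coef i * (∏ l, x l) ^ i) / (1 - ∏ l, x l)) N.domain)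
    (hN'd : N'.domain = {x | ∀ i, x i ∈ Set.Ioo (0:ℝ) 1})
    (hN'i : EqOn N'.integrand (fun x => (∑ i ∈ S', coef' i * (∏ l, x l) ^ i) / (1 - ∏ l, x l)) N'.domain)
    (hv : N.value = N'.value) : Equivalent N N' := by
  refine evenZeta_mem_relations_of_eval_eq_zero_of_mem_closure (AddSubgroup.sub_mem _
    (AddSubgroup.subset_closure (Or.inl (Or.inl ⟨k, S, coef, N, halg, hNd, hNi, rfl⟩)))
    (AddSubgroup.subset_closure (Or.inl (Or.inl ⟨k', S', coef', N', halg', hN'd, hN'i, rfl⟩)))) ?_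
  rw [map_sub, eval_of, eval_of, hv, sub_self]

/-- **A diagonal even box against an algebraic point** (e.g. `[(0,1)⁴, c(1 − t)/(1 − t)] = [(0,1)⁴, c]`
against `[pt, c]`, or a genuine zeta box against a point — then both sides must vanish): equal values
imply KZ-equivalence, unconditionally. [cite: KontsevichZagier2001, §1.2 Conjecture 1] -/
theorem evenZeta_equivalent_pt_of_value_eq (k : ℕ) (S : Finset ℕ) (coef : ℕ → ℝ)
    (halg : ∀ i ∈ S, IsAlgebraic ℚ (coef i)) (r : ℝ) (hr : IsAlgebraic ℚ r)
    (N : IntegralRep (2 * (k + 1))) (Z : IntegralRep 0)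
    (hNd : N.domain = {x | ∀ i, x i ∈ Set.Ioo (0:ℝ) 1})
    (hNi : EqOn N.integrand (fun x => (∑ i ∈ S, coef i * (∏ l, x l) ^ i) / (1 - ∏ l, x l)) N.domain)
    (hZd : Z.domain = Set.univ) (hZi : Z.integrand = fun _ => r)
    (hv : N.value = Z.value) : Equivalent N Z := by
  refine evenZeta_mem_relations_of_eval_eq_zero_of_mem_closure (AddSubgroup.sub_mem _
    (AddSubgroup.subset_closure (Or.inl (Or.inl ⟨k, S, coef, N, halg, hNd, hNi, rfl⟩)))
    (AddSubgroup.subset_closure (Or.inr ⟨r, Z, hr, hZd, hZi, rfl⟩))) ?_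
  rw [map_sub, eval_of, eval_of, hv, sub_self]

end Summit.KontsevichZagierPeriods.HurwitzMicroSectors.NormalFormPrinciple.PiBox.EvenZeta
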